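import Summits.QuantumFields.YangMills.Theorems.AtomicCalibrationRSmearedAtomicBoundAtoms
import Summits.QuantumFields.YangMills.Theorems.BalabanLadderInfVolPlaneDictionary
import HarnessLib

/-!
# E3 part 2/3 — lattice sample points in a slot ball (the near-lattice count) and the tensor atom's joint moment

* H1 `siteBox` / `piece_lattice_bound` / `piece_tsum_bound`: a piece of radius `ρ` about `c` meets at most
  `((2ρ/a+2)⁴)ⁿ` sample configurations and `|M_n| ≤ (2Cₚ)ⁿ` (`InfiniteVolume.abs_stateMomentStr_le`);
* H4 `SqrtDomClause` (the ∀-body of 28168, verbatim) / `tensorAtom_moment_le`: E1 on both RP squares + 28168 at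
  level `b := ε` ⇒ `|joint moment of the tensor atom| ≤ (C n^θ √ε)ⁿ`.

HONEST LABEL: helper lemmas / a SUPPORT stub (`stub_smearedAtomicBound`, E3) of LINES «AtomicEngine» /
«MirrorCalibration» on support item stmt-QuantumFields-28169 (ideator ym-idea-11 g15; critic idea-crit-9 #85/#86);
the wall-class items 28126 / 28168 and the open stub E2 enter only as HYPOTHESES; nothing here bears on NT/UV/IR;
no crux / rung / leaf / summit is proved; YM mass gap NOT proved.
-/

set_option autoImplicit false
noncomputable section
open scoped BigOperators
open MeasureTheory Filter Topology
open Literature.MathematicalPhysics.QuantumFieldTheory Literature.MathematicalPhysics.QuantumLattice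
open Literature.MathematicalPhysics.AQFT (IsOffDiagonal)
open Literature.Probability.LatticeModels (Site)
open Summit.QuantumFields.YangMills.Cruxes.OSLegsFromFemtoAndGap.DlrCollarTransfer (plane exists_abs_plane_le)
open Summit.QuantumFields.YangMills.Theorems.InfiniteVolume (stateMomentStr)
open Summit.QuantumFields.YangMills.Theorems.InfVolRP (centreOffset)
open Summit.QuantumFields.YangMills.Theses.OnsetTautology

namespace Summit.QuantumFields.YangMills.Cruxes.AtomicCalibrationR.MirrorCalibration

variable {G : Type} [Group G] [TopologicalSpace G] [IsTopologicalGroup G] [CompactSpace G]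
  [MeasurableSpace G] [BorelSpace G]

/-! ## §H1 Lattice sample points inside a slot ball: the site box and its count -/

omit [Group G] [TopologicalSpace G] [IsTopologicalGroup G] [CompactSpace G] [MeasurableSpace G] [BorelSpace G] in
/-- The integer box containing every site `x` whose sample point `a(x + o_q)` lies in the closed `ρ`-ball about `c`. -/
def siteBox (a : ℝ) (c : EuclideanSpace ℝ (Fin 4)) (ρ : ℝ) : Finset (Fin 4 → ℤ) :=
  Fintype.piFinset fun k : Fin 4 => Finset.Icc ⌈(c k - ρ) / a - 1⌉ ⌊(c k + ρ) / a⌋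

/-- The sample point of the smeared functional (character-for-character its lambda). -/
def samplePt (a : ℝ) {n : ℕ} (q : Fin n → Fin 4 × Fin 4) (x : Fin n → Site 4) :
    Fin n → EuclideanSpace ℝ (Fin 4) :=
  fun l => a • siteToE (x l) + (a / 2) • (EuclideanSpace.single (q l).1 (1 : ℝ) + EuclideanSpace.single (q l).2 (1 : ℝ))

omit [Group G] [TopologicalSpace G] [IsTopologicalGroup G] [CompactSpace G] [MeasurableSpace G] [BorelSpace G] in
/-- The sample point of slot `l` is the route atom argument `a • (x_l + centreOffset q_l)`. -/
theorem samplePt_apply (a : ℝ) {n : ℕ} (q : Fin n → Fin 4 × Fin 4) (hq : ∀ l, (q l).1 < (q l).2)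
    (x : Fin n → Site 4) (l : Fin n) : samplePt a q x l = a • (siteToE (x l) + centreOffset (q l)) := by
  unfold samplePt
  rw [offset_eq_centreOffset (hq l), smul_add]

omit [Group G] [TopologicalSpace G] [IsTopologicalGroup G] [CompactSpace G] [MeasurableSpace G] [BorelSpace G] in
/-- A site whose sample point lies in the slot ball belongs to the site box. -/
theorem mem_siteBox {a : ℝ} (ha : 0 < a) {q : Fin 4 × Fin 4} {c : EuclideanSpace ℝ (Fin 4)} {ρ : ℝ} {x : Site 4}
    (h : ‖a • (siteToE x + centreOffset q) - c‖ ≤ ρ) : x ∈ siteBox a c ρ := by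
  unfold siteBox
  rw [Fintype.mem_piFinset]
  intro k
  have hk0 := PiLp.norm_apply_le (a • (siteToE x + centreOffset q) - c) k
  have hk := le_trans (by simpa only [Real.norm_eq_abs] using hk0) h
  rw [atomArg_apply] at hk
  have hc := abs_le.1 hk
  have ho := centreOffset_apply_mem q k
  rw [Finset.mem_Icc]
  constructor
  · have h1 : (c k - ρ) / a - 1 ≤ ((x k : ℤ) : ℝ) := by
      rw [sub_le_iff_le_add, div_le_iff₀ ha]
      nlinarith
    exact Int.ceil_le.2 h1
  · have h1 : ((x k : ℤ) : ℝ) ≤ (c k + ρ) / a := by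
      rw [le_div_iff₀ ha]
      nlinarith
    exact Int.le_floor.2 h1

omit [Group G] [TopologicalSpace G] [IsTopologicalGroup G] [CompactSpace G] [MeasurableSpace G] [BorelSpace G] in
/-- The site box has at most `(2ρ/a + 2)⁴` elements. -/
theorem card_siteBox_le {a : ℝ} (ha : 0 < a) (c : EuclideanSpace ℝ (Fin 4)) {ρ : ℝ} (hρ : 0 ≤ ρ) :
    ((siteBox a c ρ).card : ℝ) ≤ (2 * ρ / a + 2) ^ 4 := by
  unfold siteBox
  rw [Fintype.card_piFinset]
  push_cast
  have h2 : ∀ k : Fin 4, ((Finset.Icc ⌈(c k - ρ) / a - 1⌉ ⌊(c k + ρ) / a⌋).card : ℝ) ≤ 2 * ρ / a + 2 := by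
    intro k
    rw [Int.card_Icc, ← Int.cast_natCast, Int.toNat_eq_max, Int.cast_max]
    push_cast
    refine max_le ?_ (by positivity)
    have e1 := Int.le_ceil ((c k - ρ) / a - 1)
    have e2 := Int.floor_le ((c k + ρ) / a)
    have e3 : (c k + ρ) / a - (c k - ρ) / a = 2 * ρ / a := by rw [div_sub_div_same]; ring
    linarith
  calc ∏ k : Fin 4, ((Finset.Icc ⌈(c k - ρ) / a - 1⌉ ⌊(c k + ρ) / a⌋).card : ℝ) ≤ ∏ _k : Fin 4, (2 * ρ / a + 2) :=
        Finset.prod_le_prod (fun k _ => by positivity) (fun k _ => h2 k)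
    _ = (2 * ρ / a + 2) ^ 4 := by rw [Finset.prod_const, Finset.card_univ, Fintype.card_fin]

omit [IsTopologicalGroup G] [CompactSpace G] [BorelSpace G] in
/-- **H1 `piece_lattice_bound`.**  For a real function `g` on `(ℝ⁴)ⁿ` supported in the product of the closed
`ρ`-balls about `c_l` and bounded by `Mg`: the lattice-smeared moment `x ↦ M_n(x) g(z_x)` vanishes outside the product
of site boxes, and its absolute sum is `≤ ((2ρ/a + 2)⁴)ⁿ (2Cₚ)ⁿ Mg` — for NEAR-LATTICE pieces (`ρ < a`) an `a`-free
count `≤ 256ⁿ`, and for every piece (`ρ ≤ ½`) a finite one. -/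
theorem piece_lattice_bound (r : LatticeRep G) (μ : Measure (LGConfig 4 G)) [IsProbabilityMeasure μ] {Cp : ℝ}
    (hCp : ∀ (q : Fin 4 × Fin 4) (x : Fin 4 → ℤ) (U : LGConfig 4 G), |plane G r q x U| ≤ Cp) {n : ℕ}
    (q : Fin n → Fin 4 × Fin 4) (hq : ∀ l, (q l).1 < (q l).2) {a ρ : ℝ} (ha : 0 < a) (hρ : 0 ≤ ρ)
    (c : Fin n → EuclideanSpace ℝ (Fin 4)) (g : (Fin n → EuclideanSpace ℝ (Fin 4)) → ℝ) {Mg : ℝ}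
    (hMg : ∀ z, |g z| ≤ Mg) (hsupp : ∀ z, g z ≠ 0 → ∀ l, ‖z l - c l‖ ≤ ρ) :
    (∀ x ∉ Fintype.piFinset (fun l => siteBox a (c l) ρ), stateMomentStr G r μ n q x * g (samplePt a q x) = 0) ∧
      ∑ x ∈ Fintype.piFinset (fun l => siteBox a (c l) ρ), |stateMomentStr G r μ n q x * g (samplePt a q x)| ≤
        ((2 * ρ / a + 2) ^ 4) ^ n * ((Cp + Cp) ^ n * Mg) := by
  classical
  have hCp0 : 0 ≤ Cp := le_trans (abs_nonneg _) (hCp (0, 1) 0 (fun _ => 1))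
  have hMg0 : 0 ≤ Mg := le_trans (abs_nonneg _) (hMg 0)
  constructor
  · intro x hx
    rw [Fintype.mem_piFinset, not_forall] at hx
    obtain ⟨l, hl⟩ := hx
    have hg : g (samplePt a q x) = 0 := by
      by_contra h
      have := hsupp _ h l
      rw [samplePt_apply a q hq x l] at this
      exact hl (mem_siteBox ha this)
    rw [hg, mul_zero]
  · calc ∑ x ∈ Fintype.piFinset (fun l => siteBox a (c l) ρ), |stateMomentStr G r μ n q x * g (samplePt a q x)|
        ≤ ∑ _x ∈ Fintype.piFinset (fun l => siteBox a (c l) ρ), (Cp + Cp) ^ n * Mg :=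
          Finset.sum_le_sum fun x _ => by
            rw [abs_mul]
            exact mul_le_mul (Summit.QuantumFields.YangMills.Theorems.InfiniteVolume.abs_stateMomentStr_le r μ hCp q x)
              (hMg _) (abs_nonneg _) (by positivity)
      _ = ((Fintype.piFinset (fun l => siteBox a (c l) ρ)).card : ℝ) * ((Cp + Cp) ^ n * Mg) := by
          rw [Finset.sum_const, nsmul_eq_mul]
      _ ≤ ((2 * ρ / a + 2) ^ 4) ^ n * ((Cp + Cp) ^ n * Mg) := by
          refine mul_le_mul_of_nonneg_right ?_ (by positivity)
          rw [Fintype.card_piFinset]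
          push_cast
          calc ∏ l, ((siteBox a (c l) ρ).card : ℝ) ≤ ∏ _l : Fin n, (2 * ρ / a + 2) ^ 4 :=
                Finset.prod_le_prod (fun l _ => by positivity) (fun l _ => card_siteBox_le ha (c l) hρ)
            _ = ((2 * ρ / a + 2) ^ 4) ^ n := by rw [Finset.prod_const, Finset.card_univ, Fintype.card_fin]

omit [IsTopologicalGroup G] [CompactSpace G] [BorelSpace G] in
/-- Corollary of H1: summability and the `tsum` bound. -/
theorem piece_tsum_bound (r : LatticeRep G) (μ : Measure (LGConfig 4 G)) [IsProbabilityMeasure μ] {Cp : ℝ}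
    (hCp : ∀ (q : Fin 4 × Fin 4) (x : Fin 4 → ℤ) (U : LGConfig 4 G), |plane G r q x U| ≤ Cp) {n : ℕ}
    (q : Fin n → Fin 4 × Fin 4) (hq : ∀ l, (q l).1 < (q l).2) {a ρ : ℝ} (ha : 0 < a) (hρ : 0 ≤ ρ)
    (c : Fin n → EuclideanSpace ℝ (Fin 4)) (g : (Fin n → EuclideanSpace ℝ (Fin 4)) → ℝ) {Mg : ℝ}
    (hMg : ∀ z, |g z| ≤ Mg) (hsupp : ∀ z, g z ≠ 0 → ∀ l, ‖z l - c l‖ ≤ ρ) :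
    Summable (fun x : Fin n → Site 4 => |stateMomentStr G r μ n q x * g (samplePt a q x)|) ∧
      ∑' x : Fin n → Site 4, |stateMomentStr G r μ n q x * g (samplePt a q x)| ≤
        ((2 * ρ / a + 2) ^ 4) ^ n * ((Cp + Cp) ^ n * Mg) ∧
      |∑' x : Fin n → Site 4, stateMomentStr G r μ n q x * g (samplePt a q x)| ≤
        ((2 * ρ / a + 2) ^ 4) ^ n * ((Cp + Cp) ^ n * Mg) := by
  obtain ⟨hzero, hsum⟩ := piece_lattice_bound r μ hCp q hq ha hρ c g hMg hsupp
  have hz' : ∀ x ∉ Fintype.piFinset (fun l => siteBox a (c l) ρ),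
      |stateMomentStr G r μ n q x * g (samplePt a q x)| = 0 := fun x hx => by rw [hzero x hx, abs_zero]
  refine ⟨summable_of_ne_finset_zero hz', ?_, ?_⟩
  · rw [tsum_eq_sum hz']
    exact hsum
  · rw [tsum_eq_sum hzero]
    exact (Finset.abs_sum_le_sum_abs _ _).trans hsum

/-! ## §H4 The tensor atom's joint moment: E1 ceilings on both RP squares ⇒ 28168 at level ε -/

/-- The ∀-clause of item 28168 `AtomicSqrtDominationR` at fixed `(C, θ)` in the state `μ` (character-for-character its
body after `∃ C θ β₄`). -/
def SqrtDomClause (r : LatticeRep G) (μ : Measure (LGConfig 4 G)) (C θ : ℝ) : Prop :=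
  ∀ (n : ℕ) (S : Fin n → Finset ((Fin 4 × Fin 4) × (Fin 4 → ℤ))) (w : Fin n → (Fin 4 × Fin 4) × (Fin 4 → ℤ) → ℝ)
    (b : ℝ), 2 ≤ n → 0 < b → (∀ i, ∀ p ∈ S i, p.1.1 < p.1.2) → (∀ i j, i ≠ j → ∃ (k : Fin 4) (c : ℤ),
      (((∀ p ∈ S i, p.2 k + 2 ≤ c) ∧ (∀ p ∈ S j, c + 2 ≤ p.2 k)) ∨
          ((∀ p ∈ S j, p.2 k + 2 ≤ c) ∧ (∀ p ∈ S i, c + 2 ≤ p.2 k))) ∧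
        ∑ p ∈ S i, ∑ p' ∈ S i, w i p * w i p' * stateMomentStr G r μ 2 ![p.1, p'.1]
            ![(fun l => if l = k then 2 * c - p.2 l - (if p.1.1 = k ∨ p.1.2 = k then 1 else 0) else p.2 l), p'.2] ≤ b ∧
        ∑ p ∈ S j, ∑ p' ∈ S j, w j p * w j p' * stateMomentStr G r μ 2 ![p.1, p'.1]
            ![(fun l => if l = k then 2 * c - p.2 l - (if p.1.1 = k ∨ p.1.2 = k then 1 else 0) else p.2 l), p'.2] ≤ b) →
    |∑ p ∈ Fintype.piFinset S, (∏ i, w i (p i)) * stateMomentStr G r μ n (fun i => (p i).1) (fun i => (p i).2)| ≤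
      (C * n ^ θ * Real.sqrt b) ^ n

/-- Item 28168 hands out the clause. -/
theorem sqrtDomClause_of (h : AtomicSqrtDominationR) (G₁ : Type) [Group G₁] [TopologicalSpace G₁]
    [IsTopologicalGroup G₁] [CompactSpace G₁] (hG : IsCompactSimpleLieGroup G₁)
    (hSU : Nonempty (G₁ ≃ₜ* Matrix.specialUnitaryGroup (Fin 2) ℂ)) :
    letI : MeasurableSpace G₁ := borel G₁
    haveI : BorelSpace G₁ := ⟨rfl⟩
    ∀ r : LatticeRep G₁, ∃ (C θ β₄ : ℝ), 0 ≤ C ∧ 0 ≤ θ ∧ ∀ β : ℝ, β₄ ≤ β →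
      ∀ μ ∈ oddTorusLimitPoints r β, SqrtDomClause r μ C θ :=
  h G₁ hG hSU

/-- **H4 `tensorAtom_moment_le`.**  A tensor atom of one LARGE Whitney piece (radius `ρ ≥ a`, slots `Λρ`-separated,
`Λ ≥ 4t + 12`; atom sizes `σ_l ≤ ρ`, `σ_l < 1`, centres within `2ρ`), sampled on the lattice of spacing `a ≥ sup onset`,
with `S_l` = the exact carriers: the separating plane (H3) puts every pair of slots in E1's regime, E1 bounds both RP
squares by `ε`, and 28168's clause gives `|joint moment| ≤ (C n^θ √ε)ⁿ`.  The three currencies (28168's inline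
reflected site, E1's `reflSite`, H3's real side clauses) match by `rfl` / casting. -/
theorem tensorAtom_moment_le (hE1 : AtomCeilings) (G₁ : Type) [Group G₁] [TopologicalSpace G₁]
    [IsTopologicalGroup G₁] [CompactSpace G₁] (hG : IsCompactSimpleLieGroup G₁)
    (hSU : Nonempty (G₁ ≃ₜ* Matrix.specialUnitaryGroup (Fin 2) ℂ)) :
    letI : MeasurableSpace G₁ := borel G₁
    haveI : BorelSpace G₁ := ⟨rfl⟩
    ∀ (r : LatticeRep G₁) (C θ β : ℝ) (μ : Measure (LGConfig 4 G₁)), 0 ≤ β → μ ∈ oddTorusLimitPoints r β →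
      SqrtDomClause r μ C θ →
      ∀ (b : SchwartzMap (EuclideanSpace ℝ (Fin 4)) ℝ) (t ε a ρ Λ : ℝ), IsAdmissibleProfile b → 0 ≤ t →
        (∀ u, b u ≠ 0 → ‖u‖ ≤ t) → 0 < ε → 0 < a → (∀ s ∈ onsetSet r μ b ε, s ≤ a) → a ≤ ρ → 4 * t + 12 ≤ Λ →
        ∀ (n : ℕ) (q : Fin n → Fin 4 × Fin 4) (σ : Fin n → ℝ) (η c : Fin n → EuclideanSpace ℝ (Fin 4))
          (S : Fin n → Finset ((Fin 4 × Fin 4) × (Fin 4 → ℤ))),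
          2 ≤ n → (∀ l, (q l).1 < (q l).2) → (∀ l, 0 < σ l ∧ σ l ≤ ρ ∧ σ l < 1) → (∀ l, ‖η l - c l‖ ≤ 2 * ρ) →
          (∀ l l', l ≠ l' → ∃ k : Fin 4, Λ * ρ ≤ |c l k - c l' k|) →
          (∀ l p, atomWt b {q l} (a / σ l) ((σ l)⁻¹ • η l) p ≠ 0 → p ∈ S l) →
          (∀ l, ∀ p ∈ S l, atomWt b {q l} (a / σ l) ((σ l)⁻¹ • η l) p ≠ 0) →
          |∑ p ∈ Fintype.piFinset S, (∏ l, atomWt b {q l} (a / σ l) ((σ l)⁻¹ • η l) (p l)) *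
              stateMomentStr G₁ r μ n (fun l => (p l).1) (fun l => (p l).2)| ≤ (C * n ^ θ * Real.sqrt ε) ^ n := by
  letI : MeasurableSpace G₁ := borel G₁
  haveI : BorelSpace G₁ := ⟨rfl⟩
  intro r C θ β μ hβ hμ h68 b t ε a ρ Λ hb ht hbt hε ha hA hρa hΛ n q σ η c S hn hq hσ hη hsep hS hSne
  have hval : ∀ l, ∀ p ∈ S l, (p.1 ∈ ({q l} : Finset (Fin 4 × Fin 4)) ∧ p.1.1 < p.1.2) := fun l p hp =>
    ((atomWt_ne_zero_iff b {q l} (a / σ l) ((σ l)⁻¹ • η l) p).1 (hSne l p hp)).1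
  refine h68 n S (fun l => atomWt b {q l} (a / σ l) ((σ l)⁻¹ • η l)) ε hn hε (fun i p hp => (hval i p hp).2) ?_
  intro i j hij
  obtain ⟨k, hk⟩ := hsep i j hij
  obtain ⟨cz, hcz⟩ := separating_plane ht hbt ha hρa hΛ (hσ i).1 (hσ i).2.1 (hσ j).1 (hσ j).2.1 (hη i) (hη j)
    hk (q i) (q j)
  -- E1 for cluster `l` on either side of the plane `x_k = cz`
  have hE : ∀ l, ((∀ p ∈ S l, ((p.2 k : ℤ) : ℝ) + t / (a / σ l) + 2 ≤ (cz : ℝ)) ∨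
      (∀ p ∈ S l, (cz : ℝ) + t / (a / σ l) + 2 ≤ ((p.2 k : ℤ) : ℝ))) →
      ∑ p ∈ S l, ∑ p' ∈ S l, atomWt b {q l} (a / σ l) ((σ l)⁻¹ • η l) p *
          atomWt b {q l} (a / σ l) ((σ l)⁻¹ • η l) p' *
        stateMomentStr G₁ r μ 2 ![p.1, p'.1] ![reflSite k cz p, p'.2] ≤ ε := fun l hside =>
    hE1 G₁ hG hSU r b ε β a μ hb hε hβ hμ hA (S l) (q l) (a / σ l) t ((σ l)⁻¹ • η l) k cz (hq l)
      (div_pos ha (hσ l).1) (by rw [lt_div_iff₀ (hσ l).1]; nlinarith [(hσ l).2.2]) hbt (hS l) hside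
  -- integer clauses from the real ones (`t / s ≥ 0`)
  have hZ1 : ∀ l (p : (Fin 4 × Fin 4) × (Fin 4 → ℤ)), ((p.2 k : ℤ) : ℝ) + t / (a / σ l) + 2 ≤ (cz : ℝ) →
      p.2 k + 2 ≤ cz := fun l p h => by
    have h0 : 0 ≤ t / (a / σ l) := div_nonneg ht (div_pos ha (hσ l).1).le
    have : ((p.2 k : ℤ) : ℝ) + 2 ≤ (cz : ℝ) := by linarith
    exact_mod_cast this
  have hZ2 : ∀ l (p : (Fin 4 × Fin 4) × (Fin 4 → ℤ)), (cz : ℝ) + t / (a / σ l) + 2 ≤ ((p.2 k : ℤ) : ℝ) →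
      cz + 2 ≤ p.2 k := fun l p h => by
    have h0 : 0 ≤ t / (a / σ l) := div_nonneg ht (div_pos ha (hσ l).1).le
    have : (cz : ℝ) + 2 ≤ ((p.2 k : ℤ) : ℝ) := by linarith
    exact_mod_cast this
  rcases hcz with ⟨h1, h2⟩ | ⟨h1, h2⟩
  · have s1 : ∀ p ∈ S i, ((p.2 k : ℤ) : ℝ) + t / (a / σ i) + 2 ≤ (cz : ℝ) := fun p hp => h1 p (hSne i p hp)
    have s2 : ∀ p ∈ S j, (cz : ℝ) + t / (a / σ j) + 2 ≤ ((p.2 k : ℤ) : ℝ) := fun p hp => h2 p (hSne j p hp)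
    exact ⟨k, cz, Or.inl ⟨fun p hp => hZ1 i p (s1 p hp), fun p hp => hZ2 j p (s2 p hp)⟩, hE i (Or.inl s1),
      hE j (Or.inr s2)⟩
  · have s1 : ∀ p ∈ S j, ((p.2 k : ℤ) : ℝ) + t / (a / σ j) + 2 ≤ (cz : ℝ) := fun p hp => h1 p (hSne j p hp)
    have s2 : ∀ p ∈ S i, (cz : ℝ) + t / (a / σ i) + 2 ≤ ((p.2 k : ℤ) : ℝ) := fun p hp => h2 p (hSne i p hp)
    exact ⟨k, cz, Or.inr ⟨fun p hp => hZ1 j p (s1 p hp), fun p hp => hZ2 i p (s2 p hp)⟩, hE i (Or.inr s2),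
      hE j (Or.inl s1)⟩

end Summit.QuantumFields.YangMills.Cruxes.AtomicCalibrationR.MirrorCalibration
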